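import Literature.Analysis.FluidPDE.ConfinedHardSphereFlowOrbits
import Literature.Analysis.FluidPDE.HardSphereFlowMeasurable
import HarnessLib

/-!
# Measurability of the event-by-event confined hard-sphere flow and of its good set

Fifth layer of the proof of `ConfinedHardSphereFlow.nonempty_torus_balls` (existence of the
confined hard-sphere flow on the torus among fixed round scatterers; Cercignani–Illner–Pulvirenti
1994 Thm. 4.2.1, App. 4.A): for the construction `ConfinedAlexander.flow` /
`ConfinedAlexander.good` of `ConfinedHardSphereFlowConstruction` among round scatterers
`Wall.balls G ctr ρ hρ`, in a geometry regular at `ε` and `ρ` and measurable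
(`Geometry.IsMeasurable`), the good set is measurable and each `T^t` is a measurable self-map.
Line-by-line analogue of `Literature.Analysis.FluidPDE.HardSphereFlowMeasurable` (wall-free
case), with the wall reflection, the incoming wall contacts and the wall part of the no-touch
condition added; the no-touch measurability is proved once in an abstract form
(`measurableSet_forall_ne_of_lt`: "a family of continuous gap functions never reaches its
threshold strictly inside `(0, τ)`" is a measurable condition, by rational windows and
compactness) and used for both kinds of contact.

## References

* C. Cercignani, R. Illner, M. Pulvirenti, *The Mathematical Theory of Dilute Gases*, Springer
  (1994), §4.2, App. 4.A–4.B (the flow `T^t` is integrated against, hence measurable).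
-/

open Set Filter Function MeasureTheory
open scoped ENNReal Topology InnerProductSpace

namespace Literature.Analysis.FluidPDE

noncomputable section

/-! ## An abstract measurability lemma: no threshold crossing strictly before a stopping time -/

/-- **No-touch conditions are measurable.** Let `τ` be a measurable `[0, ∞]`-valued function on
a measurable space, and `g k t w` finitely many real "gap functions", measurable in `w` at
rational times and continuous in `t`, which dominate their thresholds `c k` at all times
`0 < t < τ(w)`. Then the set of `w` for which no gap function reaches its threshold at a time
`0 < t < τ(w)` is measurable: its complement is the countable union, over rational windows
`[a, b] ⊂ (0, τ(w))`, indices `k` and the events "`g k` comes within `1/(n+1)` of `c k` at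
rational times of `(a, b)` for every `n`", by compactness of `[a, b]` and continuity. [folklore] -/
theorem measurableSet_forall_ne_of_lt {α κ : Type*} [MeasurableSpace α] [Countable κ] {τ : α → ℝ≥0∞}
    (hτ : Measurable τ) {g : κ → ℝ → α → ℝ} (hgm : ∀ k (q : ℚ), Measurable fun w => g k q w)
    (hgc : ∀ k w, Continuous fun t : ℝ => g k t w) {c : κ → ℝ}
    (hdom : ∀ w (t : ℝ), 0 < t → ENNReal.ofReal t < τ w → ∀ k, c k ≤ g k t w) :
    MeasurableSet {w | ∀ t : ℝ, 0 < t → ENNReal.ofReal t < τ w → ∀ k, g k t w ≠ c k} := by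
  set B : Set α := {w | ∃ a : ℚ, ∃ b : ℚ, ∃ k : κ, (0 : ℝ) < a ∧ ENNReal.ofReal b < τ w ∧
      ∀ n : ℕ, ∃ q : ℚ, (a : ℝ) < q ∧ (q : ℝ) < b ∧ g k q w < c k + 1 / (n + 1)} with hB
  have hBm : MeasurableSet B := by
    refine measurableSet_setOf.2 (Measurable.exists fun a => Measurable.exists fun b =>
      Measurable.exists fun k => measurable_const.and
        ((measurableSet_setOf.1 (measurableSet_lt measurable_const hτ)).and (Measurable.forall fun n =>
          Measurable.exists fun q => measurable_const.and (measurable_const.and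
            (measurableSet_setOf.1 (measurableSet_lt (hgm k q) measurable_const))))))
  suffices heq : {w | ∀ t : ℝ, 0 < t → ENNReal.ofReal t < τ w → ∀ k, g k t w ≠ c k} = Bᶜ by
    rw [heq]
    exact hBm.compl
  ext w
  simp only [mem_setOf_eq, mem_compl_iff]
  constructor
  · rintro hgood ⟨a, b, k, ha, hb, hn⟩
    choose q hq using hn
    obtain ⟨t, ht, φ, hφ, hlim⟩ := isCompact_Icc.tendsto_subseq (x := fun n => (q n : ℝ))
      (s := Icc (a : ℝ) b) fun n => ⟨(hq n).1.le, (hq n).2.1.le⟩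
    have hle : g k t w ≤ c k := by
      have hlim' := ((hgc k w).tendsto t).comp hlim
      refine le_of_forall_pos_lt_add fun δ hδ => ?_
      obtain ⟨m, hm⟩ := exists_nat_one_div_lt hδ
      have hev : ∀ᶠ n in atTop, g k (q (φ n)) w < c k + 1 / (m + 1) := by
        refine (eventually_ge_atTop m).mono fun n hn => ?_
        refine (hq (φ n)).2.2.trans_le ?_
        have hφn : (m : ℝ) + 1 ≤ (φ n : ℝ) + 1 := by exact_mod_cast Nat.succ_le_succ (hn.trans (hφ.id_le n))
        gcongr
      have := le_of_tendsto hlim' (hev.mono fun n hn => hn.le)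
      linarith
    have htτ : ENNReal.ofReal t < τ w := (ENNReal.ofReal_le_ofReal ht.2).trans_lt hb
    have hge : c k ≤ g k t w := hdom w t (ha.trans_le ht.1) htτ k
    exact hgood t (ha.trans_le ht.1) htτ k (le_antisymm hle hge)
  · intro hnot t ht0 htτ k hc
    refine hnot ?_
    obtain ⟨a, ha0, hat⟩ := exists_rat_btwn (half_pos ht0)
    obtain ⟨b, -, htb, hbτ⟩ := ENNReal.lt_iff_exists_rat_btwn.1 htτ
    change ENNReal.ofReal t < ENNReal.ofReal b at htb
    change ENNReal.ofReal b < τ w at hbτ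
    have htb' : t < b := (ENNReal.ofReal_lt_ofReal_iff_of_nonneg ht0.le).1 htb
    refine ⟨a, b, k, by linarith, hbτ, fun n => ?_⟩
    have hev : ∀ᶠ s : ℝ in 𝓝 t, g k s w < c k + 1 / (n + 1) ∧ (a : ℝ) < s ∧ s < b := by
      refine (((hgc k w).tendsto t).eventually (gt_mem_nhds ?_)).and
        ((lt_mem_nhds (by linarith)).and (gt_mem_nhds htb'))
      rw [hc]
      exact lt_add_of_pos_right _ (by positivity)
    obtain ⟨η, hη, hball⟩ := Metric.eventually_nhds_iff.1 hev
    obtain ⟨q, htq, hqη⟩ := exists_rat_btwn (lt_add_of_pos_right t hη)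
    have hdist : dist (q : ℝ) t < η := by
      rw [Real.dist_eq, abs_lt]
      constructor <;> linarith
    obtain ⟨h1, h2, h3⟩ := hball hdist
    exact ⟨q, h2, h3, h1⟩

section Kinetic

variable {d : Type*} [Fintype d] {X : Type*} {N : ℕ} {ι : Type*} [MeasurableSpace X]
  {G : Geometry d X} {ε : ℝ} {ctr : ι → X} {ρ : ℝ} {hρ : 0 < ρ}

/-! ## Measurability of the static wall maps (round scatterers) -/

namespace Geometry.IsMeasurable

/-- The separation vector of sphere `i` from a fixed point is measurable in the configuration. [folklore] -/
theorem measurable_sepVec_config_point (hG : G.IsMeasurable) (i : Fin N) (a : X) :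
    Measurable fun z : Config N d X => G.sepVec (z i).1 a :=
  hG.measurable_sepVec.comp ((measurable_pos i).prodMk measurable_const)

/-- The set of configurations in which sphere `i` touches the `k`-th round scatterer is measurable. [folklore] -/
theorem measurableSet_mem_balls_contact (hG : G.IsMeasurable) (i : Fin N) (k : ι) :
    MeasurableSet {z : Config N d X | (z i).1 ∈ (Wall.balls G ctr ρ hρ k).contact} := by
  simp only [Wall.mem_balls_contact_iff]
  exact measurableSet_eq_fun (hG.measurable_sepVec_config_point i (ctr k)).norm measurable_const

/-- The set of configurations admissible for sphere `i` and the `k`-th round scatterer is measurable. [folklore] -/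
theorem measurableSet_mem_balls_region (hG : G.IsMeasurable) (i : Fin N) (k : ι) :
    MeasurableSet {z : Config N d X | (z i).1 ∈ (Wall.balls G ctr ρ hρ k).region} := by
  simp only [Wall.mem_balls_region_iff]
  exact measurableSet_le measurable_const (hG.measurable_sepVec_config_point i (ctr k)).norm

/-- Wall-incoming for a round scatterer is a measurable condition. [folklore] -/
theorem measurableSet_isWallIncoming_balls (hG : G.IsMeasurable) (i : Fin N) (k : ι) :
    MeasurableSet {z : Config N d X | IsWallIncoming (Wall.balls G ctr ρ hρ k) z i} := by
  simp only [Wall.isWallIncoming_balls_iff]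
  exact measurableSet_lt ((hG.measurable_sepVec_config_point i (ctr k)).inner (measurable_vel i)) measurable_const

/-- Wall-outgoing for a round scatterer is a measurable condition. [folklore] -/
theorem measurableSet_isWallOutgoing_balls (hG : G.IsMeasurable) (i : Fin N) (k : ι) :
    MeasurableSet {z : Config N d X | IsWallOutgoing (Wall.balls G ctr ρ hρ k) z i} := by
  simp only [Wall.isWallOutgoing_balls_iff]
  exact measurableSet_lt measurable_const ((hG.measurable_sepVec_config_point i (ctr k)).inner (measurable_vel i))

/-- The specular reflection of sphere `i` at the `k`-th round scatterer is a measurable self-map. [folklore] -/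
theorem measurable_reflectWall_balls (hG : G.IsMeasurable) (i : Fin N) (k : ι) :
    Measurable (reflectWall (N := N) (Wall.balls G ctr ρ hρ k) i) := by
  have hn : Measurable fun z : Config N d X => ρ⁻¹ • G.sepVec (z i).1 (ctr k) :=
    (hG.measurable_sepVec_config_point i (ctr k)).const_smul ρ⁻¹
  have hv := measurable_vel (N := N) (d := d) (X := X) i
  have hR : Measurable fun z : Config N d X =>
      FunctionSpaces.specularReflect (ρ⁻¹ • G.sepVec (z i).1 (ctr k)) (z i).2 := by
    have h : (fun z : Config N d X => FunctionSpaces.specularReflect (ρ⁻¹ • G.sepVec (z i).1 (ctr k)) (z i).2) =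
        fun z => (z i).2 - (2 * ⟪(z i).2, ρ⁻¹ • G.sepVec (z i).1 (ctr k)⟫_ℝ /
          ‖ρ⁻¹ • G.sepVec (z i).1 (ctr k)‖ ^ 2) • (ρ⁻¹ • G.sepVec (z i).1 (ctr k)) :=
      funext fun z => FunctionSpaces.specularReflect_eq _ _
    rw [h]
    exact hv.sub ((((hv.inner hn).const_mul 2).div (hn.norm.pow_const 2)).smul hn)
  refine measurable_pi_lambda _ fun j => ?_
  by_cases hji : j = i
  · subst hji
    simp only [reflectWall_apply_self, Wall.balls_apply, Wall.ball_normal]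
    exact (measurable_pos j).prodMk hR
  · simp only [reflectWall_apply_of_ne _ hji]
    exact measurable_pi_apply j

end Geometry.IsMeasurable

/-- The confined domain among round scatterers is measurable (measurable geometry, countably many
scatterers). [folklore] -/
theorem measurableSet_confinedDomain_balls [Countable ι] (hGm : G.IsMeasurable) :
    MeasurableSet (confinedDomain G (Wall.balls G ctr ρ hρ) N ε) := by
  refine measurableSet_confinedDomain G hGm.measurable_sepVec (fun k => ?_) N ε
  exact measurableSet_le measurable_const (hGm.measurable_sepVec.comp (measurable_id.prodMk measurable_const)).norm

namespace ConfinedAlexander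

/-! ## Measurability of the exit time -/

section ExitTime

variable [TopologicalSpace X]

omit [MeasurableSpace X] in
open Classical in
/-- **The exit time is an infimum over rational times** (the confined domain is closed and free
flight is continuous in time). [folklore] -/
theorem exitTime_eq_iInf_rat (hG : G.IsHardSphereRegular ε) (hGρ : G.IsHardSphereRegular ρ) (z : Config N d X) :
    exitTime G (Wall.balls G ctr ρ hρ) ε z = ⨅ q : ℚ, if 0 ≤ (q : ℝ) ∧
      freeFlight G q z ∉ confinedDomain G (Wall.balls G ctr ρ hρ) N ε then ENNReal.ofReal q else ∞ := by
  set W := Wall.balls G ctr ρ hρ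
  refine le_antisymm (le_iInf fun q => ?_) (le_sInf ?_)
  · split_ifs with h
    · exact exitTime_le_of_not_mem h.1 h.2
    · exact le_top
  · rintro t ⟨ht, hmem⟩
    refine ENNReal.le_of_forall_pos_le_add fun δ hδ _ => ?_
    have hopen : ∀ᶠ s in 𝓝 t.toReal, freeFlight G s z ∉ confinedDomain G W N ε :=
      (hG.continuous_freeFlight z).continuousAt.eventually
        ((isClosed_confinedDomain hG hGρ).isOpen_compl.mem_nhds hmem)
    obtain ⟨η, hη, hball⟩ := Metric.eventually_nhds_iff.1 hopen
    have hlt : t.toReal < min (t.toReal + η) (t.toReal + δ) :=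
      lt_min (lt_add_of_pos_right _ hη) (lt_add_of_pos_right _ (by simpa using hδ))
    obtain ⟨q, htq, hq⟩ := exists_rat_btwn hlt
    have hq0 : 0 ≤ (q : ℝ) := ENNReal.toReal_nonneg.trans htq.le
    have hqmem : freeFlight G q z ∉ confinedDomain G W N ε := by
      refine hball ?_
      rw [Real.dist_eq, abs_lt]
      constructor <;> linarith [lt_min_iff.1 hq]
    calc (⨅ q : ℚ, if 0 ≤ (q : ℝ) ∧ freeFlight G q z ∉ confinedDomain G W N ε then ENNReal.ofReal q else ∞)
          ≤ ENNReal.ofReal q := by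
            refine (iInf_le _ q).trans ?_
            rw [if_pos ⟨hq0, hqmem⟩]
      _ ≤ ENNReal.ofReal (t.toReal + δ) := ENNReal.ofReal_le_ofReal (lt_min_iff.1 hq).2.le
      _ ≤ ENNReal.ofReal t.toReal + ENNReal.ofReal δ := ENNReal.ofReal_add_le
      _ = t + δ := by rw [ENNReal.ofReal_toReal ht, ENNReal.ofReal_coe_nnreal]

open Classical in
/-- **The exit time is measurable** (round scatterers, geometry regular at `ε` and `ρ` and
measurable, countably many scatterers). [folklore] -/
theorem measurable_exitTime [Countable ι] (hG : G.IsHardSphereRegular ε) (hGρ : G.IsHardSphereRegular ρ)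
    (hGm : G.IsMeasurable) : Measurable (exitTime (N := N) G (Wall.balls G ctr ρ hρ) ε) := by
  set W := Wall.balls G ctr ρ hρ
  have h : exitTime (N := N) G W ε = fun z => ⨅ q : ℚ,
      if 0 ≤ (q : ℝ) ∧ freeFlight G q z ∉ confinedDomain G W N ε then ENNReal.ofReal q else ∞ :=
    funext (exitTime_eq_iInf_rat hG hGρ)
  rw [h]
  refine Measurable.iInf fun q => Measurable.ite ?_ measurable_const measurable_const
  by_cases hq : 0 ≤ (q : ℝ)
  · simp only [hq, true_and]
    exact (hGm.measurable_freeFlight q) (measurableSet_confinedDomain_balls hGm).compl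
  · simp only [hq, false_and, setOf_false, MeasurableSet.empty]

end ExitTime

/-! ## Measurability of the event step -/

omit [MeasurableSpace X] in
/-- The event resolution through `jumpMap`. [folklore] -/
theorem eventJump_eq_jumpMap {W : ι → Wall d X} (z : Config N d X) :
    eventJump G W ε z = jumpMap G W (Alexander.incomingPairs G ε z, incomingWalls W z) z := by
  unfold eventJump jumpMap
  congr

/-- For fixed sets, `jumpMap` is measurable (round scatterers). [folklore] -/
theorem measurable_jumpMap (hGm : G.IsMeasurable) (S : Set (Fin N × Fin N) × Set (Fin N × ι)) :
    Measurable (jumpMap (N := N) G (Wall.balls G ctr ρ hρ) S) := by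
  unfold jumpMap
  split_ifs with h h'
  · exact hGm.measurable_collidePair _ _
  · exact hGm.measurable_reflectWall_balls _ _
  · exact measurable_id

/-- Membership of a fixed contact in `incomingWalls` is a measurable condition (round scatterers). [folklore] -/
theorem measurableSet_mem_incomingWalls (hGm : G.IsMeasurable) (q : Fin N × ι) :
    MeasurableSet {w : Config N d X | q ∈ incomingWalls (Wall.balls G ctr ρ hρ) w} := by
  simp only [mem_incomingWalls]
  exact (hGm.measurableSet_mem_balls_contact (hρ := hρ) q.1 q.2).inter
    (hGm.measurableSet_isWallIncoming_balls q.1 q.2)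

/-- `z ↦ eventJump (w z)` is measurable for measurable `w` (finitely many scatterers): the pair of
sets of incoming contacts takes countably many values on measurable level sets. [folklore] -/
theorem measurable_eventJump_comp [Finite ι] (hGm : G.IsMeasurable) {w : Config N d X → Config N d X}
    (hw : Measurable w) : Measurable fun z => eventJump G (Wall.balls G ctr ρ hρ) ε (w z) := by
  letI m₁ : MeasurableSpace (Set (Fin N × Fin N)) := ⊤
  letI m₂ : MeasurableSpace (Set (Fin N × ι)) := ⊤
  haveI : MeasurableSingletonClass (Set (Fin N × Fin N)) := ⟨fun _ => trivial⟩
  haveI : MeasurableSingletonClass (Set (Fin N × ι)) := ⟨fun _ => trivial⟩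
  haveI : Countable (Fin N × ι) := inferInstance
  have hF : Measurable fun p : (Set (Fin N × Fin N) × Set (Fin N × ι)) × Config N d X =>
      jumpMap G (Wall.balls G ctr ρ hρ) p.1 p.2 :=
    measurable_from_prod_countable_right fun S => measurable_jumpMap hGm S
  have hS1 : Measurable fun z => Alexander.incomingPairs G ε (w z) := by
    refine measurable_to_countable' fun S => ?_
    have hset : (fun z => Alexander.incomingPairs G ε (w z)) ⁻¹' {S} =
        ⋂ p : Fin N × Fin N, {z | p ∈ Alexander.incomingPairs G ε (w z) ↔ p ∈ S} := by
      ext z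
      simp only [mem_preimage, mem_singleton_iff, mem_iInter, mem_setOf_eq, Set.ext_iff]
    rw [hset]
    refine MeasurableSet.iInter fun p => measurableSet_setOf.2 ?_
    exact (measurableSet_setOf.1 ((Alexander.measurableSet_mem_incomingPairs hGm p).preimage hw)).iff measurable_const
  have hS2 : Measurable fun z => incomingWalls (Wall.balls G ctr ρ hρ) (w z) := by
    refine measurable_to_countable' fun S => ?_
    have hset : (fun z => incomingWalls (Wall.balls G ctr ρ hρ) (w z)) ⁻¹' {S} =
        ⋂ q : Fin N × ι, {z | q ∈ incomingWalls (Wall.balls G ctr ρ hρ) (w z) ↔ q ∈ S} := by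
      ext z
      simp only [mem_preimage, mem_singleton_iff, mem_iInter, mem_setOf_eq, Set.ext_iff]
    rw [hset]
    refine MeasurableSet.iInter fun q => measurableSet_setOf.2 ?_
    exact (measurableSet_setOf.1 ((measurableSet_mem_incomingWalls hGm q).preimage hw)).iff measurable_const
  have h := hF.comp ((hS1.prodMk hS2).prodMk hw)
  simpa only [Function.comp_def, eventJump_eq_jumpMap] using h

section Step

variable [TopologicalSpace X] [Finite ι]

/-- **The event step is measurable.** [folklore] -/
theorem measurable_eventStep (hG : G.IsHardSphereRegular ε) (hGρ : G.IsHardSphereRegular ρ) (hGm : G.IsMeasurable) :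
    Measurable (eventStep (N := N) G (Wall.balls G ctr ρ hρ) ε) := by
  set W := Wall.balls G ctr ρ hρ
  haveI : Countable ι := Finite.to_countable
  have hτ := measurable_exitTime (N := N) hG hGρ hGm (ctr := ctr) (hρ := hρ)
  have hz' : Measurable fun z : Config N d X => freeFlight G (exitTime G W ε z).toReal z :=
    hGm.measurable_freeFlight₂.comp (hτ.ennreal_toReal.prodMk measurable_id)
  have h : eventStep (N := N) G W ε = fun z => if exitTime G W ε z = ∞ then z else
      eventJump G W ε (freeFlight G (exitTime G W ε z).toReal z) := rfl
  rw [h]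
  exact Measurable.ite (hτ (measurableSet_singleton ∞)) measurable_id (measurable_eventJump_comp hGm hz')

/-- The `k`-th post-event state is a measurable function of the datum. [folklore] -/
theorem measurable_stateAfter (hG : G.IsHardSphereRegular ε) (hGρ : G.IsHardSphereRegular ρ) (hGm : G.IsMeasurable)
    (k : ℕ) : Measurable fun z : Config N d X => stateAfter G (Wall.balls G ctr ρ hρ) ε z k :=
  (measurable_eventStep hG hGρ hGm).iterate k

/-- The `k`-th event instant is a measurable function of the datum. [folklore] -/
theorem measurable_eventInstant (hG : G.IsHardSphereRegular ε) (hGρ : G.IsHardSphereRegular ρ) (hGm : G.IsMeasurable)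
    (k : ℕ) : Measurable fun z : Config N d X => eventInstant G (Wall.balls G ctr ρ hρ) ε z k := by
  haveI : Countable ι := Finite.to_countable
  induction k with
  | zero => simp only [eventInstant_zero, measurable_const]
  | succ k ih =>
    simp only [eventInstant_succ]
    exact ih.add ((measurable_exitTime hG hGρ hGm).comp (measurable_stateAfter hG hGρ hGm k))

/-! ## Measurability of the event counts and of the flow -/

/-- The number of events in `[0, t]` is a measurable function of the datum. [folklore] -/
theorem measurable_eventCount (hG : G.IsHardSphereRegular ε) (hGρ : G.IsHardSphereRegular ρ) (hGm : G.IsMeasurable)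
    (t : ℝ) : Measurable fun z : Config N d X => eventCount G (Wall.balls G ctr ρ hρ) ε z t := by
  set W := Wall.balls G ctr ρ hρ
  refine measurable_to_countable' fun k => ?_
  have hA : ∀ m, MeasurableSet {z : Config N d X | eventInstant G W ε z m ≤ ENNReal.ofReal t} :=
    fun m => measurableSet_le (measurable_eventInstant hG hGρ hGm m) measurable_const
  have hset : (fun z : Config N d X => eventCount G W ε z t) ⁻¹' {k} =
      {z | (eventInstant G W ε z k ≤ ENNReal.ofReal t ∧ ¬eventInstant G W ε z (k + 1) ≤ ENNReal.ofReal t) ∨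
        (k = 0 ∧ ∀ m, eventInstant G W ε z m ≤ ENNReal.ofReal t)} := by
    ext z
    simp only [mem_preimage, mem_singleton_iff, mem_setOf_eq]
    exact Nat.sSup_eq_iff_of_lowerSet (S := {m | eventInstant G W ε z m ≤ ENNReal.ofReal t})
      (by simp) (fun m n hmn hn => (monotone_eventInstant z hmn).trans hn) k
  rw [hset]
  refine measurableSet_setOf.2 ((((measurableSet_setOf.1 (hA k)).and
    (measurableSet_setOf.1 (hA (k + 1))).not)).or (measurable_const.and
      (Measurable.forall fun m => measurableSet_setOf.1 (hA m))))

/-- The number of events in `[0, t)` is a measurable function of the datum. [folklore] -/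
theorem measurable_eventCountBefore (hG : G.IsHardSphereRegular ε) (hGρ : G.IsHardSphereRegular ρ)
    (hGm : G.IsMeasurable) (t : ℝ) :
    Measurable fun z : Config N d X => eventCountBefore G (Wall.balls G ctr ρ hρ) ε z t := by
  set W := Wall.balls G ctr ρ hρ
  rcases le_or_gt t 0 with ht | ht
  · have h : (fun z : Config N d X => eventCountBefore G W ε z t) = fun _ => 0 := by
      funext z
      exact eventCountBefore_eq_zero_of_le (by simp [ENNReal.ofReal_of_nonpos ht])
    rw [h]
    exact measurable_const
  refine measurable_to_countable' fun k => ?_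
  have hA : ∀ m, MeasurableSet {z : Config N d X | eventInstant G W ε z m < ENNReal.ofReal t} :=
    fun m => measurableSet_lt (measurable_eventInstant hG hGρ hGm m) measurable_const
  have hset : (fun z : Config N d X => eventCountBefore G W ε z t) ⁻¹' {k} =
      {z | (eventInstant G W ε z k < ENNReal.ofReal t ∧ ¬eventInstant G W ε z (k + 1) < ENNReal.ofReal t) ∨
        (k = 0 ∧ ∀ m, eventInstant G W ε z m < ENNReal.ofReal t)} := by
    ext z
    simp only [mem_preimage, mem_singleton_iff, mem_setOf_eq]
    exact Nat.sSup_eq_iff_of_lowerSet (S := {m | eventInstant G W ε z m < ENNReal.ofReal t})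
      (by simpa using ht) (fun m n hmn hn => (monotone_eventInstant z hmn).trans_lt hn) k
  rw [hset]
  refine measurableSet_setOf.2 ((((measurableSet_setOf.1 (hA k)).and
    (measurableSet_setOf.1 (hA (k + 1))).not)).or (measurable_const.and
      (Measurable.forall fun m => measurableSet_setOf.1 (hA m))))

/-- **Each forward flow map is measurable.** [folklore] -/
theorem measurable_fwdFlow (hG : G.IsHardSphereRegular ε) (hGρ : G.IsHardSphereRegular ρ) (hGm : G.IsMeasurable)
    (t : ℝ) : Measurable fun z : Config N d X => fwdFlow G (Wall.balls G ctr ρ hρ) ε z t := by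
  set W := Wall.balls G ctr ρ hρ
  have hF : Measurable fun p : ℕ × Config N d X =>
      freeFlight G (t - (eventInstant G W ε p.2 p.1).toReal) (stateAfter G W ε p.2 p.1) :=
    measurable_from_prod_countable_right fun k => hGm.measurable_freeFlight₂.comp
      ((measurable_const.sub (measurable_eventInstant hG hGρ hGm k).ennreal_toReal).prodMk
        (measurable_stateAfter hG hGρ hGm k))
  unfold fwdFlow
  exact hF.comp ((measurable_eventCount hG hGρ hGm t).prodMk measurable_id)

/-- **Each left-continuous forward flow map is measurable.** [folklore] -/
theorem measurable_fwdFlowLeft (hG : G.IsHardSphereRegular ε) (hGρ : G.IsHardSphereRegular ρ) (hGm : G.IsMeasurable)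
    (t : ℝ) : Measurable fun z : Config N d X => fwdFlowLeft G (Wall.balls G ctr ρ hρ) ε z t := by
  set W := Wall.balls G ctr ρ hρ
  have hF : Measurable fun p : ℕ × Config N d X =>
      freeFlight G (t - (eventInstant G W ε p.2 p.1).toReal) (stateAfter G W ε p.2 p.1) :=
    measurable_from_prod_countable_right fun k => hGm.measurable_freeFlight₂.comp
      ((measurable_const.sub (measurable_eventInstant hG hGρ hGm k).ennreal_toReal).prodMk
        (measurable_stateAfter hG hGρ hGm k))
  unfold fwdFlowLeft
  exact hF.comp ((measurable_eventCountBefore hG hGρ hGm t).prodMk measurable_id)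

/-- **Each time-`t` map of the two-sided confined flow is measurable.** [folklore] -/
theorem measurable_flow (hG : G.IsHardSphereRegular ε) (hGρ : G.IsHardSphereRegular ρ) (hGm : G.IsMeasurable)
    (t : ℝ) : Measurable (flow (N := N) G (Wall.balls G ctr ρ hρ) ε t) := by
  set W := Wall.balls G ctr ρ hρ
  by_cases ht : 0 ≤ t
  · have h : flow (N := N) G W ε t = fun z => fwdFlow G W ε z t := funext fun z => flow_of_nonneg ht z
    rw [h]
    exact measurable_fwdFlow hG hGρ hGm t
  · have h : flow (N := N) G W ε t = fun z => flipVel (fwdFlowLeft G W ε (flipVel z) (-t)) :=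
      funext fun z => flow_of_neg (not_le.1 ht) z
    rw [h]
    exact measurable_flipVel.comp ((measurable_fwdFlowLeft hG hGρ hGm (-t)).comp measurable_flipVel)

end Step

/-! ## Measurability of the good set -/

/-- The set of simple pair-event configurations is measurable. [folklore] -/
theorem measurableSet_isSimplePairEvent [Countable ι] (hGm : G.IsMeasurable) :
    MeasurableSet {z : Config N d X | IsSimplePairEvent G (Wall.balls G ctr ρ hρ) ε z} := by
  simp only [IsSimplePairEvent, setOf_and]
  refine (Alexander.measurableSet_isSimpleIncoming hGm).inter ?_
  refine measurableSet_setOf.2 (Measurable.forall fun i => Measurable.forall fun k => ?_)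
  exact (measurableSet_setOf.1 (hGm.measurableSet_mem_balls_contact i k)).not

/-- The set of simple wall-event configurations is measurable. [folklore] -/
theorem measurableSet_isSimpleWallEvent [Countable ι] (hGm : G.IsMeasurable) :
    MeasurableSet {z : Config N d X | IsSimpleWallEvent G (Wall.balls G ctr ρ hρ) ε z} := by
  have hc : ∀ i j : Fin N, MeasurableSet (contactSet G N ε i j) := fun i j =>
    measurableSet_contactSet G hGm.measurable_sepVec N ε i j
  haveI : Countable (Fin N × ι) := inferInstance
  refine measurableSet_setOf.2 (Measurable.exists fun q => (measurableSet_setOf.1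
    (hGm.measurableSet_mem_balls_contact q.1 q.2)).and ((measurableSet_setOf.1
      (hGm.measurableSet_isWallIncoming_balls q.1 q.2)).and ((Measurable.forall fun i =>
        Measurable.forall fun k => (measurableSet_setOf.1 (hGm.measurableSet_mem_balls_contact i k)).imp
          measurable_const).and (Measurable.forall fun i => Measurable.forall fun j =>
            measurable_const.imp (measurableSet_setOf.1 (hc i j)).not))))

/-- The set of simple event configurations is measurable. [folklore] -/
theorem measurableSet_isSimpleEvent [Countable ι] (hGm : G.IsMeasurable) :
    MeasurableSet {z : Config N d X | IsSimpleEvent G (Wall.balls G ctr ρ hρ) ε z} :=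
  (measurableSet_isSimplePairEvent hGm).union (measurableSet_isSimpleWallEvent hGm)

section NoTouch

variable [TopologicalSpace X] [Finite ι]

/-- **No touch of either kind inside the first free flight is a measurable condition** (via the
abstract `measurableSet_forall_ne_of_lt`, with the pair distances and the distances to the
scatterer centres as gap functions). [folklore] -/
theorem measurableSet_noTouch (hG : G.IsHardSphereRegular ε) (hGρ : G.IsHardSphereRegular ρ) (hGm : G.IsMeasurable) :
    MeasurableSet {w : Config N d X | ∀ t : ℝ, 0 < t → ENNReal.ofReal t < exitTime G (Wall.balls G ctr ρ hρ) ε w →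
      (∀ i j : Fin N, i ≠ j → freeFlight G t w ∉ contactSet G N ε i j) ∧
      ∀ (i : Fin N) (k' : ι), (freeFlight G t w i).1 ∉ (Wall.balls G ctr ρ hρ k').contact} := by
  set W := Wall.balls G ctr ρ hρ
  haveI : Countable ι := Finite.to_countable
  have hτ := measurable_exitTime (N := N) hG hGρ hGm (ctr := ctr) (hρ := hρ)
  -- pairs
  set κ₁ := {p : Fin N × Fin N // p.1 ≠ p.2}
  set g₁ : κ₁ → ℝ → Config N d X → ℝ := fun p t w => ‖G.sepVec (freeFlight G t w p.1.1).1 (freeFlight G t w p.1.2).1‖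
  have h1 : MeasurableSet {w | ∀ t : ℝ, 0 < t → ENNReal.ofReal t < exitTime G W ε w → ∀ p, g₁ p t w ≠ ε} := by
    refine measurableSet_forall_ne_of_lt (c := fun _ => ε) hτ (fun p q => ?_) (fun p w => ?_) (fun w t ht hlt p => ?_)
    · exact ((hGm.measurable_sepVec_config p.1.1 p.1.2).comp (hGm.measurable_freeFlight q)).norm
    · simpa only [Function.comp_def] using (hG.continuous_norm_sepVec_config p.1.1 p.1.2).comp (hG.continuous_freeFlight w)
    · exact (freeFlight_mem_confinedDomain_of_lt ht.le hlt).1 p.1.1 p.1.2 p.2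
  -- walls
  set g₂ : Fin N × ι → ℝ → Config N d X → ℝ := fun q t w => ‖G.sepVec (freeFlight G t w q.1).1 (ctr q.2)‖
  have h2 : MeasurableSet {w | ∀ t : ℝ, 0 < t → ENNReal.ofReal t < exitTime G W ε w → ∀ q, g₂ q t w ≠ ρ} := by
    refine measurableSet_forall_ne_of_lt (c := fun _ => ρ) hτ (fun q r => ?_) (fun q w => ?_) (fun w t ht hlt q => ?_)
    · exact ((hGm.measurable_sepVec_config_point q.1 (ctr q.2)).comp (hGm.measurable_freeFlight r)).norm
    · simpa only [Function.comp_def] using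
        (hGρ.continuous_norm_sepVec_config_point q.1 (ctr q.2)).comp (hG.continuous_freeFlight w)
    · exact (freeFlight_mem_confinedDomain_of_lt ht.le hlt).2 q.1 q.2
  have heq : {w : Config N d X | ∀ t : ℝ, 0 < t → ENNReal.ofReal t < exitTime G W ε w →
      (∀ i j : Fin N, i ≠ j → freeFlight G t w ∉ contactSet G N ε i j) ∧
      ∀ (i : Fin N) (k' : ι), (freeFlight G t w i).1 ∉ (W k').contact} =
      {w | ∀ t : ℝ, 0 < t → ENNReal.ofReal t < exitTime G W ε w → ∀ p, g₁ p t w ≠ ε} ∩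
      {w | ∀ t : ℝ, 0 < t → ENNReal.ofReal t < exitTime G W ε w → ∀ q, g₂ q t w ≠ ρ} := by
    ext w
    simp only [mem_setOf_eq, mem_inter_iff]
    constructor
    · intro h
      refine ⟨fun t ht hlt p hp => (h t ht hlt).1 p.1.1 p.1.2 p.2 ⟨(freeFlight_mem_confinedDomain_of_lt ht.le hlt).1, hp⟩,
        fun t ht hlt q hq => (h t ht hlt).2 q.1 q.2 (Wall.mem_balls_contact_iff.2 hq)⟩
    · rintro ⟨hp, hq⟩ t ht hlt
      exact ⟨fun i j hij hc => hp t ht hlt ⟨(i, j), hij⟩ hc.2, fun i k hc => hq t ht hlt (i, k) (Wall.mem_balls_contact_iff.1 hc)⟩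
  rw [heq]
  exact h1.inter h2

end NoTouch

section Good

variable [TopologicalSpace X] [Finite ι]

/-- **The set of forward-good data is measurable.** [folklore] -/
theorem measurableSet_fwdGood (hG : G.IsHardSphereRegular ε) (hGρ : G.IsHardSphereRegular ρ) (hGm : G.IsMeasurable) :
    MeasurableSet {z : Config N d X | FwdGood G (Wall.balls G ctr ρ hρ) ε z} := by
  set W := Wall.balls G ctr ρ hρ
  haveI : Countable ι := Finite.to_countable
  have hτ := measurable_exitTime (N := N) hG hGρ hGm (ctr := ctr) (hρ := hρ)
  have hst := measurable_stateAfter (N := N) hG hGρ hGm (ctr := ctr) (hρ := hρ)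
  have hexit : ∀ k, Measurable fun z : Config N d X =>
      freeFlight G (exitTime G W ε (stateAfter G W ε z k)).toReal (stateAfter G W ε z k) := fun k =>
    hGm.measurable_freeFlight₂.comp (((hτ.comp (hst k)).ennreal_toReal).prodMk (hst k))
  refine measurableSet_setOf.2 ((Measurable.forall fun k => ?_).and ((Measurable.forall fun k => ?_).and ?_))
  · exact (measurableSet_setOf.1 ((hτ.comp (hst k)) (measurableSet_singleton ∞))).not.imp
      (measurableSet_setOf.1 ((measurableSet_isSimpleEvent hGm).preimage (hexit k)))
  · exact measurableSet_setOf.1 ((measurableSet_noTouch hG hGρ hGm).preimage (hst k))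
  · have hsum : Measurable fun z : Config N d X => ∑' k, exitTime G W ε (stateAfter G W ε z k) := by
      simp_rw [ENNReal.tsum_eq_iSup_sum]
      exact Measurable.iSup fun s => Finset.measurable_fun_sum s fun k _ => hτ.comp (hst k)
    exact measurableSet_setOf.1 (hsum (measurableSet_singleton ∞))

/-- **The good set `Γ₀` is measurable** (round scatterers, geometry regular at `ε` and `ρ` and
measurable, finitely many scatterers). [folklore] -/
theorem measurableSet_good (hG : G.IsHardSphereRegular ε) (hGρ : G.IsHardSphereRegular ρ) (hGm : G.IsMeasurable) :
    MeasurableSet (good (N := N) G (Wall.balls G ctr ρ hρ) ε) := by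
  haveI : Countable ι := Finite.to_countable
  have hc : ∀ i j : Fin N, MeasurableSet (contactSet G N ε i j) := fun i j =>
    measurableSet_contactSet G hGm.measurable_sepVec N ε i j
  have hw : ∀ (i : Fin N) (k : ι), MeasurableSet {z : Config N d X | (z i).1 ∈ (Wall.balls G ctr ρ hρ k).contact} :=
    fun i k => hGm.measurableSet_mem_balls_contact i k
  refine (measurableSet_confinedDomain_balls hGm).inter (MeasurableSet.inter ?_ (MeasurableSet.inter ?_
    ((measurableSet_fwdGood hG hGρ hGm).inter ((measurableSet_fwdGood hG hGρ hGm).preimage measurable_flipVel))))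
  · refine measurableSet_setOf.2 (Measurable.forall fun i => Measurable.forall fun j =>
      measurable_const.imp ((measurableSet_setOf.1 (hc i j)).imp
        ((measurableSet_setOf.1 (hGm.measurableSet_isOutgoing i j)).and
          ((Measurable.forall fun i' => Measurable.forall fun j' => measurable_const.imp
            ((measurableSet_setOf.1 (hc i' j')).imp measurable_const)).and
          (Measurable.forall fun i' => Measurable.forall fun k => (measurableSet_setOf.1 (hw i' k)).not)))))
  · refine measurableSet_setOf.2 (Measurable.forall fun i => Measurable.forall fun k =>
      (measurableSet_setOf.1 (hw i k)).imp ((measurableSet_setOf.1 (hGm.measurableSet_isWallOutgoing_balls i k)).and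
        ((Measurable.forall fun i' => Measurable.forall fun k' => (measurableSet_setOf.1 (hw i' k')).imp
          measurable_const).and (Measurable.forall fun i' => Measurable.forall fun j' =>
            measurable_const.imp (measurableSet_setOf.1 (hc i' j')).not))))

end Good

/-- **Measurability of the constructed confined flow on the flat torus among round scatterers**,
`ε < 1/2`, `0 < ρ < 1/2`: the good set is measurable and each `T^t` is a measurable self-map. [folklore] -/
theorem flow_measurable_torus [Finite ι] {ε ρ : ℝ} (hε' : ε < 2⁻¹) (hρ : 0 < ρ) (hρ' : ρ < 2⁻¹)
    (ctr : ι → UnitAddTorus d) (N : ℕ) :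
    MeasurableSet (good (N := N) (Torus.geometry d) (Wall.balls (Torus.geometry d) ctr ρ hρ) ε) ∧
    ∀ t : ℝ, Measurable (flow (N := N) (Torus.geometry d) (Wall.balls (Torus.geometry d) ctr ρ hρ) ε t) := by
  have hG := Torus.isHardSphereRegular_geometry (d := d) hε'
  have hGρ := Torus.isHardSphereRegular_geometry (d := d) hρ'
  have hGm := Torus.isMeasurable_geometry (d := d)
  exact ⟨measurableSet_good hG hGρ hGm, fun t => measurable_flow hG hGρ hGm t⟩

end ConfinedAlexander

end Kinetic

end

end Literature.Analysis.FluidPDE
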